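import Literature.NumberTheory.EllipticCurves.ProfiniteGroupDistributionTwoVariableIntegral
import HarnessLib

/-!
# Bounded distributions on a group along a subgroup tower: the coset formula II.4.7 (16) for an INDUCED
# measure with ANY system of coset representatives — `∫_Γ χ d i(b) = Σ_{c ∈ Γ/U_0} χ(t_c) · ∫_H 𝟙_{U_0} χ d i_H(t_c⁻¹ • b)`
# for every section `t` of `Γ → Γ/U_0` (de Shalit's `σ_𝔠` = Artin symbols of ideals representing `Gal(F/K)`)

Topic `NumberTheory/EllipticCurves`; namespace `Literature.NumberTheory.EllipticCurves.GroupDistribution`.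

De Shalit, *Iwasawa theory of elliptic curves with complex multiplication* (1987), II.4.7 (16) (p. 60):
"`∫_𝒢 χφ^k dμ⁰_β = Σ_𝔠 χφ^k(𝔠⁻¹) · ∫_G φ^k dμ⁰_{σ_𝔠(β)}`", the sum "over ideals `𝔠` representing `Gal(F/K) = 𝒢/G`" —
the representatives ARE the Artin symbols `σ_𝔠 = (𝔠, F_∞/K)` of integral ideals, chosen so that II.2.4 (ii)
(`σ_𝔠 e(𝔞) · e(𝔠)^{N𝔞} = e(𝔞𝔠)`) evaluates the conjugate units `σ_𝔠(β)` (II.4.10, p. 64).  I.3.4 Lemma (ii) (p. 18):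
"this is independent of `γ`" — the value of the extended measure on a coset does not depend on the representative.

`ProfiniteGroupDistributionInduceFromSubgroup.lean` proved the coset formula `integral_induceFrom_of_mul` with the tower's
FIXED representatives `r_c = 𝒰.repr 0 c` (`Quotient.out`).  THIS file frees the representatives: for an `H`-equivariant
family `i_H` (`U_0 ≤ H`) every term `χ(r) · ∫_H 𝟙_{U_0} χ d i_H(r⁻¹ • b)` depends on `r` only through the coset `r U_0`:

* §1 `integral_smul_eq_integral_comp_mul` — **`∫_H f d i_H(h • b) = ∫_H f(h·) d i_H(b)`** for `h ∈ H` (the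
  `H`-equivariance of `i_H` read on integrals: `i_H(h • b) = δ_h * i_H(b)`, `integral_twisting` at `c = 0`);
* §2 `indicator_mul_integral_eq_of_mem` — **`χ(r h) · ∫_H 𝟙_{U_0} χ d i_H((r h)⁻¹ • b) = χ(r) · ∫_H 𝟙_{U_0} χ d i_H(r⁻¹ • b)`**
  for `h ∈ U_0` and multiplicative `χ` with `χ(1) = 1` (I.3.4 Lemma (ii));
* §3 ★★ `integral_induceFrom_of_mul_section` / `…_of_le_section` — **the coset formula for ANY section `t : Γ/U_0 → Γ`**,
  `𝒰.proj 0 (t c) = c`: `∫_Γ χ d i(b) = Σ_{c ∈ Γ/U_0} χ(t_c) · ∫_H 𝟙_{U_0} χ d i_H(t_c⁻¹ • b)`, indicator-free when `H = U_0`;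
  and ★★ `integral_eq_sum_of_twisting_eq_induceFrom_section[_of_le]` — the same behind the division (29)↔(31):
  `∫_Γ χ dE = (χ(σ_𝔠) − N𝔠)⁻¹ Σ_c χ(t_c) ∫_H [𝟙_{U_0}] χ d i_H(t_c⁻¹ • β_𝔠)`;
* §5 ★★ `integral_eq_sum_of_glue_induceFrom_section[_of_le]` — the same for the GLUED two-variable measure read at the
  modulus `m` (II.4.14 (38) first line; `integral_eq_of_glue_at` of `ProfiniteGroupDistributionTwoVariableIntegral.lean`).

Everything is a theorem; no named facts, no instances, no `sorry`.

## References

* [deShalit1987] E. de Shalit, *Iwasawa theory of elliptic curves with complex multiplication* (1987),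
  II.4.7 (16) (p. 60), I.3.4 Lemma (ii) (p. 18), II.4.10 (p. 64), II.4.12 (29)–(31) (p. 67–69).
-/

noncomputable section

open Filter
open scoped Topology Classical

namespace Literature.NumberTheory.EllipticCurves

namespace GroupDistribution

variable {Γ : Type*} [Group Γ] {H : Subgroup Γ} {𝒰 : SubgroupTower Γ} {𝒱 : SubgroupTower H}
  [∀ n, (𝒰.U n).Normal] (hV : ∀ n, 𝒱.U n = (𝒰.U n).subgroupOf H)
  {𝕜 : Type*} [NormedField 𝕜] [IsUltrametricDist 𝕜] [CompleteSpace 𝕜]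
  {B : Type*} [CommMonoid B] [MulDistribMulAction Γ B]
  (iH : B → GroupDistribution 𝒱 𝕜) {C : ℝ} (hC0 : 0 ≤ C) (hC : ∀ b, (iH b).bound ≤ C)
  [∀ n, (𝒱.U n).Normal] (hH : 𝒰.U 0 ≤ H)
  (hiH_smul : ∀ (h : H) (b : B) (n : ℕ) (a : H ⧸ 𝒱.U n),
    (iH ((h : Γ) • b)).μ n (𝒱.proj n h * a) = (iH b).μ n a)

/-! ### §1. The `H`-equivariance of `i_H` read on integrals -/

omit [∀ n, (𝒰.U n).Normal] [CompleteSpace 𝕜] in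
include hiH_smul in
/-- **`i_H(h • b) = δ_h * i_H(b)` levelwise**: `i_H(h • b)_n(a) = i_H(b)_n(h̄⁻¹ a)` (the `H`-equivariance in twisting
notation, `c = 0`). [cite: deShalit1987, I.3.4 Lemma (ii) (p. 18), II.4.6 (p. 59)] -/
theorem μ_smul_eq_twisting_zero (h : H) (b : B) (n : ℕ) (a : H ⧸ 𝒱.U n) :
    (iH ((h : Γ) • b)).μ n a = (twisting h 0 (iH b)).μ n a := by
  rw [twisting_μ, zero_mul, sub_zero, ← hiH_smul h b n ((𝒱.proj n h)⁻¹ * a), mul_inv_cancel_left]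

omit [∀ n, (𝒰.U n).Normal] in
include hiH_smul in
/-- ★ **`∫_H f d i_H(h • b) = ∫_H f(h y) d i_H(b)(y)`** for `h ∈ H` and `f` tower-continuous on `H` (`integral_twisting` at `c = 0`).
[cite: deShalit1987, I.3.4 Lemma (ii) (p. 18), II.4.6 (p. 59)] -/
theorem integral_smul_eq_integral_comp_mul (h : H) (b : B) {f : H → 𝕜} (hf : 𝒱.IsTowerContinuous f) :
    (iH ((h : Γ) • b)).integral f = (iH b).integral (fun y ↦ f (h * y)) := by
  rw [integral_congr_of_μ_eq _ _ (μ_smul_eq_twisting_zero iH hiH_smul h b) f, integral_twisting h 0 (iH b) hf, zero_mul,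
    sub_zero]

/-! ### §2. The coset term is independent of the representative (I.3.4 Lemma (ii)) -/

include hV hH hiH_smul in
/-- ★ **Independence of the representative**: for `r ∈ Γ`, `h ∈ U_0 ⊆ H`, `b ∈ B` and a multiplicative tower-continuous
`χ` with `χ(1) = 1`: `χ(r h) · ∫_H 𝟙_{U_0} χ d i_H((r h)⁻¹ • b) = χ(r) · ∫_H 𝟙_{U_0} χ d i_H(r⁻¹ • b)` — `(rh)⁻¹ • b = h⁻¹ • (r⁻¹ • b)`,
the integral against `i_H(h⁻¹ • b′)` is that of `y ↦ 𝟙_{U_0}(h⁻¹y) χ(h⁻¹y) = χ(h)⁻¹ · 𝟙_{U_0}(y) χ(y)` against `i_H(b′)`.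
[cite: deShalit1987, I.3.4 Lemma (ii) (p. 18), II.4.7 (16) (p. 60)] -/
theorem indicator_mul_integral_eq_of_mem (r : Γ) {h : Γ} (hh : h ∈ 𝒰.U 0) (b : B) {χ : Γ → 𝕜}
    (hχ : 𝒰.IsTowerContinuous χ) (hmul : ∀ x y, χ (x * y) = χ x * χ y) (h1 : χ 1 = 1) :
    χ (r * h) * (iH ((r * h)⁻¹ • b)).integral (fun y : H ↦ (if 𝒰.proj 0 (y : Γ) = 1 then (1 : 𝕜) else 0) * χ y) =
      χ r * (iH (r⁻¹ • b)).integral (fun y : H ↦ (if 𝒰.proj 0 (y : Γ) = 1 then (1 : 𝕜) else 0) * χ y) := by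
  set k : H := ⟨h, hH hh⟩ with hk
  have hsmul : (r * h)⁻¹ • b = ((k⁻¹ : H) : Γ) • (r⁻¹ • b) := by
    rw [mul_inv_rev, mul_smul]; rfl
  have hk1 : 𝒰.proj 0 ((k⁻¹ : H) : Γ) = 1 := by
    rw [← 𝒰.proj_one 0, 𝒰.proj_eq_iff, Subgroup.coe_inv, inv_inv, mul_one]; exact hh
  have hχk : χ h * χ ((k⁻¹ : H) : Γ) = 1 := by
    rw [← hmul, Subgroup.coe_inv, hk, mul_inv_cancel, h1]
  rw [hsmul, integral_smul_eq_integral_comp_mul iH hiH_smul k⁻¹ (r⁻¹ • b) (isTowerContinuous_indicator_mul_coe hV hχ)]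
  have hfun : ∀ y : H, (if 𝒰.proj 0 ((k⁻¹ * y : H) : Γ) = 1 then (1 : 𝕜) else 0) * χ ((k⁻¹ * y : H) : Γ) =
      χ ((k⁻¹ : H) : Γ) * ((if 𝒰.proj 0 (y : Γ) = 1 then (1 : 𝕜) else 0) * χ y) := by
    intro y
    rw [Subgroup.coe_mul, 𝒰.proj_mul, hk1, one_mul, hmul, mul_left_comm]
  rw [integral_congr _ hfun, integral_const_mul _ _ (isTowerContinuous_indicator_mul_coe hV hχ), ← mul_assoc, hmul,
    mul_assoc (χ r), hχk, mul_one]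

/-! ### §3. The coset formula for any section of representatives -/

include hH hiH_smul in
/-- ★★ **The coset formula (16) with ANY system of representatives**: for a section `t : Γ/U_0 → Γ` (`𝒰.proj 0 (t c) = c`)
and a multiplicative tower-continuous `χ` with `χ(1) = 1`,
`∫_Γ χ d i(b) = Σ_{c ∈ Γ/U_0} χ(t_c) · ∫_H 𝟙_{U_0} χ d i_H(t_c⁻¹ • b)` — e.g. `t_c` = lifts of the Artin symbols of ideals representing
`Gal(K(𝔣)/K)`, or their inverses (de Shalit's `Σ_𝔠 χ(𝔠⁻¹) ∫_G … dμ_{σ_𝔠(β)}`). [cite: deShalit1987, II.4.7 (16) (p. 60), I.3.4 Lemma (ii) (p. 18)] -/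
theorem integral_induceFrom_of_mul_section (t : Γ ⧸ 𝒰.U 0 → Γ) (ht : ∀ c, 𝒰.proj 0 (t c) = c) (b : B) {χ : Γ → 𝕜}
    (hχ : 𝒰.IsTowerContinuous χ) (hmul : ∀ x y, χ (x * y) = χ x * χ y) (h1 : χ 1 = 1) :
    (induceFrom hV iH hC0 hC b).integral χ =
      ∑ c ∈ 𝒰.cells 0, χ (t c) * (iH ((t c)⁻¹ • b)).integral
        (fun y : H ↦ (if 𝒰.proj 0 (y : Γ) = 1 then (1 : 𝕜) else 0) * χ y) := by
  rw [integral_induceFrom_of_mul hV iH hC0 hC b hχ hmul]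
  refine Finset.sum_congr rfl fun c _ ↦ ?_
  -- `t c = r_c · h` with `h = r_c⁻¹ t_c ∈ U_0`
  have hh : (𝒰.repr 0 c)⁻¹ * t c ∈ 𝒰.U 0 := 𝒰.proj_eq_iff.mp (by rw [𝒰.proj_repr, ht])
  have h := indicator_mul_integral_eq_of_mem hV iH hH hiH_smul (𝒰.repr 0 c) hh b hχ hmul h1
  rw [mul_inv_cancel_left] at h
  exact h.symm

include hH hiH_smul in
/-- ★★ **The same when `H = U_0`** (indicator-free): `∫_Γ χ d i(b) = Σ_{c ∈ Γ/H} χ(t_c) · ∫_H χ d i_H(t_c⁻¹ • b)` for any section `t`.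
[cite: deShalit1987, II.4.7 (16) (p. 60), I.3.4 Lemma (ii) (p. 18)] -/
theorem integral_induceFrom_of_mul_of_le_section (hH' : H ≤ 𝒰.U 0) (t : Γ ⧸ 𝒰.U 0 → Γ) (ht : ∀ c, 𝒰.proj 0 (t c) = c)
    (b : B) {χ : Γ → 𝕜} (hχ : 𝒰.IsTowerContinuous χ) (hmul : ∀ x y, χ (x * y) = χ x * χ y) (h1 : χ 1 = 1) :
    (induceFrom hV iH hC0 hC b).integral χ =
      ∑ c ∈ 𝒰.cells 0, χ (t c) * (iH ((t c)⁻¹ • b)).integral (fun y : H ↦ χ y) := by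
  rw [integral_induceFrom_of_mul_section hV iH hC0 hC hH hiH_smul t ht b hχ hmul h1]
  refine Finset.sum_congr rfl fun c _ ↦ ?_
  congr 1
  refine integral_congr _ fun y ↦ ?_
  have hy1 : 𝒰.proj 0 (y : Γ) = 1 := (QuotientGroup.eq_one_iff _).mpr (hH' y.2)
  rw [if_pos hy1, one_mul]

/-! ### §4. Behind the division (29)↔(31): the integrals of `μ(𝔣)` with any section -/

section Division

open TwistingDiv

variable {p : ℕ} [hp : Fact p.Prime] {I : Type*}
  (iH' : B → GroupDistribution 𝒱 ℂ_[p]) (hC' : ∀ b, (iH' b).bound ≤ C)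
  (hiH'_smul : ∀ (h : H) (b : B) (n : ℕ) (a : H ⧸ 𝒱.U n),
    (iH' ((h : Γ) • b)).μ n (𝒱.proj n h * a) = (iH' b).μ n a)
  (β : I → B) (σ : I → Γ) (Nm : I → ℕ)

include hH hiH'_smul in
/-- ★★ **The integrals of `μ(𝔣)` on `𝒢` with any section of representatives**: if `δ_{σ_𝔠,N𝔠} E = i(β_𝔠)` levelwise for every
`𝔠`, then for every `𝔠`, every section `t` and every tower-continuous multiplicative `χ` with `χ(1) = 1`, `χ(σ_𝔠) ≠ N𝔠`:
`∫_Γ χ dE = (χ(σ_𝔠) − N𝔠)⁻¹ · Σ_{c ∈ Γ/U_0} χ(t_c) · ∫_H 𝟙_{U_0} χ d i_H(t_c⁻¹ • β_𝔠)`.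
[cite: deShalit1987, II.4.12 (29)↔(31) (p. 67–69), II.4.7 (16) (p. 60)] -/
theorem integral_eq_sum_of_twisting_eq_induceFrom_section (E : GroupDistribution 𝒰 ℂ_[p])
    (hE : ∀ (c : I) (n : ℕ) (b : Γ ⧸ 𝒰.U n),
      (twisting (σ c) (Nm c : ℂ_[p]) E).μ n b = (induceFrom hV iH' hC0 hC' (β c)).μ n b)
    (c : I) (t : Γ ⧸ 𝒰.U 0 → Γ) (ht : ∀ c, 𝒰.proj 0 (t c) = c)
    {χ : Γ → ℂ_[p]} (hχc : 𝒰.IsTowerContinuous χ) (hχ : ∀ x y, χ (x * y) = χ x * χ y)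
    (h1 : χ 1 = 1) (hne : χ (σ c) ≠ (Nm c : ℂ_[p])) :
    E.integral χ = (χ (σ c) - (Nm c : ℂ_[p]))⁻¹ *
      ∑ c' ∈ 𝒰.cells 0, χ (t c') * (iH' ((t c')⁻¹ • β c)).integral
        (fun y : H ↦ (if 𝒰.proj 0 (y : Γ) = 1 then (1 : ℂ_[p]) else 0) * χ y) := by
  rw [integral_eq_of_units (induceFrom hV iH' hC0 hC') β σ Nm E hE c hχc hχ h1 hne,
    integral_induceFrom_of_mul_section hV iH' hC0 hC' hH hiH'_smul t ht (β c) hχc hχ h1]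

include hH hiH'_smul in
/-- The same with `H = U_0` (indicator-free): `∫_Γ χ dE = (χ(σ_𝔠) − N𝔠)⁻¹ Σ_{c ∈ Γ/H} χ(t_c) ∫_H χ d i_H(t_c⁻¹ • β_𝔠)`.
[cite: deShalit1987, II.4.12 (29)↔(31) (p. 67–69), II.4.7 (16) (p. 60)] -/
theorem integral_eq_sum_of_twisting_eq_induceFrom_of_le_section (hH' : H ≤ 𝒰.U 0) (E : GroupDistribution 𝒰 ℂ_[p])
    (hE : ∀ (c : I) (n : ℕ) (b : Γ ⧸ 𝒰.U n),
      (twisting (σ c) (Nm c : ℂ_[p]) E).μ n b = (induceFrom hV iH' hC0 hC' (β c)).μ n b)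
    (c : I) (t : Γ ⧸ 𝒰.U 0 → Γ) (ht : ∀ c, 𝒰.proj 0 (t c) = c)
    {χ : Γ → ℂ_[p]} (hχc : 𝒰.IsTowerContinuous χ) (hχ : ∀ x y, χ (x * y) = χ x * χ y)
    (h1 : χ 1 = 1) (hne : χ (σ c) ≠ (Nm c : ℂ_[p])) :
    E.integral χ = (χ (σ c) - (Nm c : ℂ_[p]))⁻¹ *
      ∑ c' ∈ 𝒰.cells 0, χ (t c') * (iH' ((t c')⁻¹ • β c)).integral (fun y : H ↦ χ y) := by
  rw [integral_eq_of_units (induceFrom hV iH' hC0 hC') β σ Nm E hE c hχc hχ h1 hne,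
    integral_induceFrom_of_mul_of_le_section hV iH' hC0 hC' hH hiH'_smul hH' t ht (β c) hχc hχ h1]

end Division

/-! ### §5. The glued two-variable measure read at the modulus `m`, with any section -/

section Glue

open TwistingDiv

variable {p : ℕ} [hp : Fact p.Prime]
  {𝒰' : ℕ → SubgroupTower Γ} {href : ∀ m n, (𝒰' (m + 1)).U n ≤ (𝒰' m).U n} [∀ m n, ((𝒰' m).U n).Normal]
  {B' : ℕ → Type*} {I : Type*} {H' : ℕ → Subgroup Γ} {𝒱' : (m : ℕ) → SubgroupTower (H' m)}
  (hV' : ∀ m n, (𝒱' m).U n = ((𝒰' m).U n).subgroupOf (H' m))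
  [∀ m, CommMonoid (B' m)] [∀ m, MulDistribMulAction Γ (B' m)]
  (iH' : (m : ℕ) → B' m → GroupDistribution (𝒱' m) ℂ_[p]) {C' : ℝ} (hC0' : 0 ≤ C')
  (hC' : ∀ m (b : B' m), (iH' m b).bound ≤ C')
  (β : (m : ℕ) → I → B' m) (σ : I → Γ) (Nm : I → ℕ) [∀ m n, ((𝒱' m).U n).Normal]

/-- ★★ **The integrals of the glued two-variable measure at the modulus `m`, with ANY section of `Γ/U^{(m)}_0`**:
if `δ_{σ_𝔠,N𝔠} E = i_n(β_𝔠^{(n)})` at every level `n` (`i_n = induceFrom i_{H_n}`, `U^{(m)}_0 ≤ H_m`, `i_{H_m}` `H_m`-equivariant) and the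
`i_m(β_𝔠^{(m)})` are compatible under coarsening, then for every `m`, every section `t` of `Γ → Γ/U^{(m)}_0` and every multiplicative
`χ` with `χ(1) = 1`, continuous for `𝒰^{(m)}`, `χ(σ_𝔠) ≠ N𝔠`:
`∫_𝒢 χ dE = (χ(σ_𝔠) − N𝔠)⁻¹ · Σ_{c ∈ 𝒢/U^{(m)}_0} χ(t_c) · ∫_{H_m} 𝟙_{U^{(m)}_0} χ d i_{H_m}(t_c⁻¹ • β_𝔠^{(m)})`.
[cite: deShalit1987, II.4.14 (38) (p. 71–72), II.4.12 (29)↔(31) (p. 67–69), II.4.7 (16) (p. 60), I.3.4 Lemma (ii) (p. 18)] -/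
theorem integral_eq_sum_of_glue_induceFrom_section
    (E : GroupDistribution (SubgroupTower.diagonal 𝒰' href) ℂ_[p]) (c : I)
    (hE : ∀ (n : ℕ) (b : Γ ⧸ (𝒰' n).U n), (twisting (σ c) (Nm c : ℂ_[p]) E).μ n b =
      (induceFrom (hV' n) (iH' n) hC0' (hC' n) (β n c)).μ n b)
    (hcompat : ∀ (m n : ℕ) (a : Γ ⧸ (𝒰' m).U n),
      ((induceFrom (hV' (m + 1)) (iH' (m + 1)) hC0' (hC' (m + 1)) (β (m + 1) c)).pushforward (MonoidHom.id Γ)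
        (SubgroupTower.le_comap_id 𝒰' href m)).μ n a = (induceFrom (hV' m) (iH' m) hC0' (hC' m) (β m c)).μ n a)
    (m : ℕ) (hH : (𝒰' m).U 0 ≤ H' m)
    (hiH_smul : ∀ (h : H' m) (b : B' m) (n : ℕ) (a : H' m ⧸ (𝒱' m).U n),
      (iH' m ((h : Γ) • b)).μ n ((𝒱' m).proj n h * a) = (iH' m b).μ n a)
    (t : Γ ⧸ (𝒰' m).U 0 → Γ) (ht : ∀ c, (𝒰' m).proj 0 (t c) = c)
    {χ : Γ → ℂ_[p]} (hχc : (𝒰' m).IsTowerContinuous χ)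
    (hχ : ∀ x y, χ (x * y) = χ x * χ y) (h1 : χ 1 = 1) (hne : χ (σ c) ≠ (Nm c : ℂ_[p])) :
    E.integral χ = (χ (σ c) - (Nm c : ℂ_[p]))⁻¹ *
      ∑ c' ∈ (𝒰' m).cells 0, χ (t c') * (iH' m ((t c')⁻¹ • β m c)).integral
        (fun y : H' m ↦ (if (𝒰' m).proj 0 (y : Γ) = 1 then (1 : ℂ_[p]) else 0) * χ y) := by
  rw [integral_eq_of_glue_at (href := href) (fun m b ↦ induceFrom (hV' m) (iH' m) hC0' (hC' m) b) β σ Nm E c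
      hE hC0' (fun _ ↦ le_rfl) hcompat m hχc hχ h1 hne,
    integral_induceFrom_of_mul_section (hV' m) (iH' m) hC0' (hC' m) hH hiH_smul t ht (β m c) hχc hχ h1]

/-- ★★ **The same when `H_m = U^{(m)}_0`** (indicator-free):
`∫_𝒢 χ dE = (χ(σ_𝔠) − N𝔠)⁻¹ · Σ_{c ∈ 𝒢/H_m} χ(t_c) · ∫_{H_m} χ d i_{H_m}(t_c⁻¹ • β_𝔠^{(m)})` for any section `t`.
[cite: deShalit1987, II.4.14 (38) (p. 71–72), II.4.12 (29)↔(31) (p. 67–69), II.4.7 (16) (p. 60), II.4.17 (p. 77–78)] -/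
theorem integral_eq_sum_of_glue_induceFrom_of_le_section
    (E : GroupDistribution (SubgroupTower.diagonal 𝒰' href) ℂ_[p]) (c : I)
    (hE : ∀ (n : ℕ) (b : Γ ⧸ (𝒰' n).U n), (twisting (σ c) (Nm c : ℂ_[p]) E).μ n b =
      (induceFrom (hV' n) (iH' n) hC0' (hC' n) (β n c)).μ n b)
    (hcompat : ∀ (m n : ℕ) (a : Γ ⧸ (𝒰' m).U n),
      ((induceFrom (hV' (m + 1)) (iH' (m + 1)) hC0' (hC' (m + 1)) (β (m + 1) c)).pushforward (MonoidHom.id Γ)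
        (SubgroupTower.le_comap_id 𝒰' href m)).μ n a = (induceFrom (hV' m) (iH' m) hC0' (hC' m) (β m c)).μ n a)
    (m : ℕ) (hH : (𝒰' m).U 0 ≤ H' m) (hH' : H' m ≤ (𝒰' m).U 0)
    (hiH_smul : ∀ (h : H' m) (b : B' m) (n : ℕ) (a : H' m ⧸ (𝒱' m).U n),
      (iH' m ((h : Γ) • b)).μ n ((𝒱' m).proj n h * a) = (iH' m b).μ n a)
    (t : Γ ⧸ (𝒰' m).U 0 → Γ) (ht : ∀ c, (𝒰' m).proj 0 (t c) = c)
    {χ : Γ → ℂ_[p]} (hχc : (𝒰' m).IsTowerContinuous χ)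
    (hχ : ∀ x y, χ (x * y) = χ x * χ y) (h1 : χ 1 = 1) (hne : χ (σ c) ≠ (Nm c : ℂ_[p])) :
    E.integral χ = (χ (σ c) - (Nm c : ℂ_[p]))⁻¹ *
      ∑ c' ∈ (𝒰' m).cells 0, χ (t c') * (iH' m ((t c')⁻¹ • β m c)).integral (fun y : H' m ↦ χ y) := by
  rw [integral_eq_of_glue_at (href := href) (fun m b ↦ induceFrom (hV' m) (iH' m) hC0' (hC' m) b) β σ Nm E c
      hE hC0' (fun _ ↦ le_rfl) hcompat m hχc hχ h1 hne,
    integral_induceFrom_of_mul_of_le_section (hV' m) (iH' m) hC0' (hC' m) hH hiH_smul hH' t ht (β m c) hχc hχ h1]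

end Glue

end GroupDistribution

end Literature.NumberTheory.EllipticCurves

end
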